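import Literature.IUT.LogThetaLattice.GlobalPacketsLocalizationModel
import HarnessLib

/-!
# [IUTchIII] Proposition 3.3 (ii), archimedean clause: NON-VACUITY of the number-field model

S. Mochizuki, *Inter-universal Teichmüller theory III*, kurims manuscript (May 2020), §3, Proposition
3.3 (ii) p. 100 [claim: Mochizuki2012, status: disputed] (D-0012 claim key; the content here is
classical). PROOF-ONLY companion (theorems only) of `GlobalPacketsLocalizationModel.lean`
(abc-iut-w4-d037, p412179); abc-iut cell wave 5 (seat abc-iut-w5-d039, RQ7 second-pass audit of
p412179, finding F2); node **IUTchIII:Prop3.3(ii)** (archimedean clause, model level).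

That file discharges abc-iut-L6-t4's `Prop33ii_integersArc` for the model with the archimedean
integral structure `integralPureTensors K A ∞` (pure tensors of vectors of absolute value `≤ 1`) and
certifies NON-VACUITY only at the nonarchimedean places (`locAt_single_inv_prime_not_mem`). Since the
interface predicate is parametrised by a FREE family of subsets `Oarc`, the archimedean clause has
content only if `Oarc ∞ ≠ ⊤`; this file supplies the kernel witness: the image of `2 ∈ (†𝕄⊛_mod)_α = K`
is NOT in `integralPureTensors K A ∞` (`locAt_single_two_not_mem_integralPureTensors`), via the
multiplication map `⊗_α (Π_w K_w) → Π_w K_w` (`‖∏_α y_α(w)‖ ≤ 1` for integral `y`, while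
`‖(2)_w‖ = 2`). Nothing here bears on the disputed [IUTchIII] Cor. 3.12; typed ≠ endorsed.
-/

noncomputable section

namespace Literature.IUT.LogThetaLattice

namespace LocalizationModel

open NumberField PiTensorProduct
open scoped TensorProduct

variable (K : Type) [Field K] [NumberField K] (A : Type)

/-- `‖(2)_w‖ = 2` in the archimedean completion `K_w` of a number field `K` at an infinite place `w`
(`‖(x)_w‖ = w(x) = ‖σ_w(x)‖`, Mathlib `InfinitePlace.Completion.norm_coe`,
`InfinitePlace.norm_embedding_eq`). [folklore] -/
private theorem norm_diag_two (w : Idx K none) : ‖diag K none (2 : K) w‖ = 2 := by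
  rw [diag_apply]
  show ‖(algebraMap K (InfinitePlace.Completion w) (2 : K))‖ = 2
  rw [InfinitePlace.Completion.algebraMap_apply,
    show (((2 : K) : K) : InfinitePlace.Completion w) =
      ((WithAbs.toAbs (w : InfinitePlace K).1 (2 : K) : WithAbs (w : InfinitePlace K).1) :
        InfinitePlace.Completion w) from rfl,
    InfinitePlace.Completion.norm_coe]
  show (w : InfinitePlace K) (2 : K) = 2
  rw [← InfinitePlace.norm_embedding_eq, map_ofNat, Complex.norm_ofNat]

/-- **NON-VACUITY of `prop33ii_integersArc_model`** ([IUTchIII] Prop. 3.3 (ii) p. 100, archimedean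
clause "maps the set of archimedean integers … into the direct product of subsets constituted by the
integral structures", number-field model of abc-iut-w4-d037): the localization homomorphism does NOT
send every element of `(†𝕄⊛_mod)_α = K` into the archimedean integral structure — the image of `2`
(absolute value `2 > 1` at every archimedean prime) is not a pure tensor of vectors of absolute value
`≤ 1`: the multiplication `⊗_α (Π_w K_w) → Π_w K_w`, `⊗_α y_α ↦ ∏_α y_α` (Mathlib
`PiTensorProduct.lift` of `MultilinearMap.mkPiAlgebra`) carries `integralPureTensors K A ∞` into the
closed unit balls (`‖∏_α y_α(w)‖ = ∏_α ‖y_α(w)‖ ≤ 1`) but sends the image of `2` to `(2)_w`. Hence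
`integralPureTensors K A ∞ ≠ ⊤` and the archimedean integrality clause has content (twin of the
nonarchimedean certificate `locAt_single_inv_prime_not_mem`). Kernel check of non-vacuity;
**IUTchIII:Prop3.3(ii)** model. [claim: Mochizuki2012, status: disputed] -/
theorem locAt_single_two_not_mem_integralPureTensors [Fintype A] [DecidableEq A] (α : A) :
    locAt K A none (GlobalPacket.single (fun _ : A => K) α (2 : K)) ∉
      integralPureTensors K A none := by
  rintro ⟨y, hy, hyeq⟩
  obtain ⟨w⟩ := instNonemptyIdx K none
  -- the multiplication map `⊗_α y_α ↦ ∏_α y_α`, as a `ℚ`-linear map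
  let m : packet K A none →ₗ[ℚ] Loc K none :=
    PiTensorProduct.lift (MultilinearMap.mkPiAlgebra ℚ A (Loc K none))
  have hm : ∀ z : A → Loc K none, m (PiTensorProduct.tprod ℚ z) = ∏ β, z β := fun z => by
    simp only [m, PiTensorProduct.lift.tprod, MultilinearMap.mkPiAlgebra_apply]
  -- integral pure tensors go to the closed unit ball at `w`
  have hle : ‖m (PiTensorProduct.tprod ℚ y) w‖ ≤ 1 := by
    rw [hm, Finset.prod_apply, norm_prod]
    exact Finset.prod_le_one (fun β _ => norm_nonneg _) fun β _ => hy β w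
  -- but the image of `2` goes to `(2)_w`, of absolute value `2`
  rw [← hyeq, locAt_single, hm, Finset.prod_pi_mulSingle', if_pos (Finset.mem_univ α),
    norm_diag_two] at hle
  norm_num at hle

end LocalizationModel

end Literature.IUT.LogThetaLattice

end
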